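import Literature.MathematicalPhysics.QuantumLattice.FinDimSpectrumProofs
import Literature.Analysis.InnerProduct.CourantFischerBounds
import Summits.HubbardSuperconductivity.HubbardSuperconductivity.Theorems.BalabanIRBirEveryGroundStatePencil

/-!
# Route BalabanIR — target `BirGroundStateAverageLRO`: Weyl's inequality along a Hermitian pencil and the eigenvalue pattern at a coupling of maximal count

Helper file `--supports stmt-HubbardSuperconductivity-2079` (THESES-FREE: imports Literature
modules and the Theses-free toolkit `Theorems.BalabanIRBirEveryGroundStatePencil` only). First
half of the proof that the exceptional couplings of the SECTOR ground multiplicity of an affine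
Hermitian pencil are countable (`Theorems/BalabanIRBirGroundStateAverageLROSectorMultiplicity.lean`),
which upgrades the window uniformisation of the target's pointwise floor
(`Theorems/BalabanIRBirGroundStateAverageLROWindowUniformisation.lean`) from "off a meagre set"
to "off a countable set" of couplings:

* `abs_eigenvalues_sub_eigenvalues_le` — WEYL's inequality for Hermitian matrices in
  `dotProduct` language (Mathlib's index-aligned sorted `Matrix.IsHermitian.eigenvalues`;
  transported from the tree's `Literature.Analysis.InnerProduct.abs_eigenvalues_sub_eigenvalues_le`
  along `toEuclideanLin`), and along a pencil `abs_eigenvalues_pencil_sub_le`: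
  `|λᵢ(u) - λᵢ(u₀)| ≤ |u - u₀| Σ|M₁ᵢₖ|`;
* `eq_iff_eq_of_close_of_card_image_le` — a pattern lemma (close tuples with a gap and no more
  distinct values than at the base point induce the same partition); hence at a coupling of
  MAXIMAL distinct-eigenvalue count — all but finitely many couplings,
  `exists_finset_forall_card_roots_le` (Hermite–Sylvester) — the eigenvalue partition, the
  order of the distinct eigenvalues and so the lowest multiplicity are locally constant
  (`eventually_eigenvalues_pattern`, `eventually_finrank_groundMultiplet_top_eq`).

Kato (1966) II-§1.1, §5.1 ("finitely many exceptional points"); Horn–Johnson (2013) Cor. 4.3.15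
(Weyl). All statements are folklore linear algebra; no definition is introduced.
-/

noncomputable section

namespace Summit.HubbardSuperconductivity.HubbardSuperconductivity.Theorems

open Matrix Filter Topology
open Literature.MathematicalPhysics.QuantumLattice

section Weyl

variable {n : Type*} [Fintype n] [DecidableEq n]

omit [DecidableEq n] in
/-- `Re (v ⬝ star w) = Re (star v ⬝ w)`. [folklore] -/
theorem re_dotProduct_star_eq (v w : n → ℂ) : (v ⬝ᵥ star w).re = (star v ⬝ᵥ w).re := by
  simp only [dotProduct, Complex.re_sum, Pi.star_apply, Complex.star_def, Complex.mul_re,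
    Complex.conj_re, Complex.conj_im]
  refine Finset.sum_congr rfl fun i _ => ?_
  ring

/-- The quadratic form of `toEuclideanLin M` in `dotProduct` language:
`re ⟪M x, x⟫ = Re (star x ⬝ᵥ M x)`. [folklore] -/
theorem re_inner_toEuclideanLin_apply_self (M : Matrix n n ℂ) (x : EuclideanSpace ℂ n) :
    RCLike.re (inner ℂ (toEuclideanLin M x) x) =
      (star (WithLp.ofLp x) ⬝ᵥ M *ᵥ WithLp.ofLp x).re := by
  rw [EuclideanSpace.inner_eq_star_dotProduct]
  exact re_dotProduct_star_eq _ _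

omit [DecidableEq n] in
/-- `‖x‖² = Re (star x ⬝ᵥ x)` on `EuclideanSpace ℂ n`. [folklore] -/
theorem norm_sq_eq_re_star_dotProduct (x : EuclideanSpace ℂ n) :
    ‖x‖ ^ 2 = (star (WithLp.ofLp x) ⬝ᵥ WithLp.ofLp x).re := by
  rw [← inner_self_eq_norm_sq (𝕜 := ℂ), EuclideanSpace.inner_eq_star_dotProduct]
  exact re_dotProduct_star_eq _ _

/-- **Weyl's inequality for Hermitian matrices** (index-aligned sorted eigenvalues
`Matrix.IsHermitian.eigenvalues`): if `|Re ⟨x, (B - A) x⟩| ≤ c ‖x‖²` for all `x`, then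
`|λᵢ(B) - λᵢ(A)| ≤ c` for every `i` (the tree's
`Literature.Analysis.InnerProduct.abs_eigenvalues_sub_eigenvalues_le`, transported along
`toEuclideanLin`; Horn–Johnson, *Matrix Analysis* (2013), Cor. 4.3.15). [folklore] -/
theorem abs_eigenvalues_sub_eigenvalues_le {A B : Matrix n n ℂ} (hA : A.IsHermitian)
    (hB : B.IsHermitian) {c : ℝ}
    (hc : ∀ x : n → ℂ, |(star x ⬝ᵥ (B - A) *ᵥ x).re| ≤ c * (star x ⬝ᵥ x).re) (i : n) :
    |hB.eigenvalues i - hA.eigenvalues i| ≤ c := by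
  have hTA : (toEuclideanLin A).IsSymmetric := isSymmetric_toEuclideanLin_iff.mpr hA
  have hTB : (toEuclideanLin B).IsSymmetric := isSymmetric_toEuclideanLin_iff.mpr hB
  have hc' : ∀ x : EuclideanSpace ℂ n,
      |RCLike.re (inner ℂ ((toEuclideanLin B - toEuclideanLin A) x) x)| ≤ c * ‖x‖ ^ 2 := by
    intro x
    rw [← map_sub, re_inner_toEuclideanLin_apply_self, norm_sq_eq_re_star_dotProduct]
    exact hc _
  have key := Literature.Analysis.InnerProduct.abs_eigenvalues_sub_eigenvalues_le hTA hTB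
    finrank_euclideanSpace hc' ((Fintype.equivOfCardEq (Fintype.card_fin _)).symm i)
  simpa [Matrix.IsHermitian.eigenvalues, Matrix.IsHermitian.eigenvalues₀] using key

/-- **Pattern lemma.** If `|f i - g i| ≤ c` for all `i`, distinct values of `g` are more than
`2c` apart, and `f` takes at most as many values as `g`, then `f` and `g` induce the same
partition of the index set (`g i ≠ g j ⇒ f i ≠ f j` by the gap, so `i ↦ g i` factors through
`f` onto the image of `g`; a surjection between finite sets of the same size is injective,
`Finset.inj_on_of_surj_on_of_card_le`). [folklore] -/
theorem eq_iff_eq_of_close_of_card_image_le {α : Type*} [Fintype α] [DecidableEq α]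
    {f g : α → ℝ} {c : ℝ} (hclose : ∀ i, |f i - g i| ≤ c)
    (hgap : ∀ i j, g i ≠ g j → 2 * c < |g i - g j|)
    (hcard : (Finset.univ.image f).card ≤ (Finset.univ.image g).card) (i j : α) :
    f i = f j ↔ g i = g j := by
  classical
  have hfg : ∀ i j, f i = f j → g i = g j := by
    intro i j hij
    by_contra hne
    have h1 := hgap i j hne
    have h2 : |g i - g j| ≤ |f i - g i| + |f j - g j| := by
      calc |g i - g j| = |(f j - g j) - (f i - g i)| := by rw [hij]; ring_nf
        _ ≤ |f j - g j| + |f i - g i| := abs_sub _ _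
        _ = |f i - g i| + |f j - g j| := add_comm _ _
    linarith [hclose i, hclose j]
  refine ⟨hfg i j, fun hg => ?_⟩
  set s := Finset.univ.image f with hs
  set t := Finset.univ.image g with ht
  have hex : ∀ y ∈ s, ∃ a, f a = y := fun y hy => by
    obtain ⟨a, -, ha⟩ := Finset.mem_image.1 hy
    exact ⟨a, ha⟩
  let φ : ∀ y ∈ s, ℝ := fun y hy => g (Classical.choose (hex y hy))
  have hφ_spec : ∀ y (hy : y ∈ s), f (Classical.choose (hex y hy)) = y := fun y hy =>
    Classical.choose_spec (hex y hy)
  have hmem : ∀ k, f k ∈ s := fun k => Finset.mem_image_of_mem f (Finset.mem_univ k)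
  have hφf : ∀ k, φ (f k) (hmem k) = g k := fun k => hfg _ _ (hφ_spec (f k) (hmem k))
  have hmaps : ∀ y hy, φ y hy ∈ t := fun y hy => Finset.mem_image_of_mem g (Finset.mem_univ _)
  have hsurj : ∀ z ∈ t, ∃ y hy, φ y hy = z := by
    intro z hz
    obtain ⟨k, -, rfl⟩ := Finset.mem_image.1 hz
    exact ⟨f k, hmem k, hφf k⟩
  exact Finset.inj_on_of_surj_on_of_card_le φ hmaps hsurj hcard (hmem i) (hmem j)
    (by rw [hφf, hφf, hg])

omit [DecidableEq n] in
/-- `|Re ⟨x, Y x⟩| ≤ (Σᵢₖ |Yᵢₖ|) · Re ⟨x, x⟩` for every vector `x` (each `|xᵢ||xₖ| ≤ ‖x‖²`).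
[folklore] -/
theorem abs_re_rayleigh_le_sum_norm_mul (Y : Matrix n n ℂ) (x : n → ℂ) :
    |(star x ⬝ᵥ Y *ᵥ x).re| ≤ (∑ i, ∑ k, ‖Y i k‖) * (star x ⬝ᵥ x).re := by
  have hxx : (star x ⬝ᵥ x).re = ∑ i, ‖x i‖ ^ 2 := by
    simp only [dotProduct, Pi.star_apply, Complex.re_sum]
    refine Finset.sum_congr rfl fun i _ => ?_
    rw [Complex.star_def, ← Complex.normSq_eq_conj_mul_self, Complex.normSq_eq_norm_sq]
    norm_cast
  have hxi : ∀ i, ‖x i‖ ^ 2 ≤ (star x ⬝ᵥ x).re := fun i => by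
    rw [hxx]
    exact Finset.single_le_sum (f := fun j => ‖x j‖ ^ 2) (fun _ _ => by positivity)
      (Finset.mem_univ i)
  have hprod : ∀ i k, ‖x i‖ * ‖x k‖ ≤ (star x ⬝ᵥ x).re := fun i k => by
    nlinarith [hxi i, hxi k, norm_nonneg (x i), norm_nonneg (x k), sq_nonneg (‖x i‖ - ‖x k‖)]
  calc |(star x ⬝ᵥ Y *ᵥ x).re| ≤ ‖star x ⬝ᵥ Y *ᵥ x‖ := Complex.abs_re_le_norm _
    _ = ‖∑ i, star (x i) * ∑ k, Y i k * x k‖ := by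
        simp only [dotProduct, mulVec, Pi.star_apply]
    _ ≤ ∑ i, ‖star (x i) * ∑ k, Y i k * x k‖ := norm_sum_le _ _
    _ ≤ ∑ i, ∑ k, ‖Y i k‖ * (‖x i‖ * ‖x k‖) := by
        refine Finset.sum_le_sum fun i _ => ?_
        rw [norm_mul, norm_star]
        calc ‖x i‖ * ‖∑ k, Y i k * x k‖ ≤ ‖x i‖ * ∑ k, ‖Y i k * x k‖ :=
              mul_le_mul_of_nonneg_left (norm_sum_le _ _) (norm_nonneg _)
          _ = ∑ k, ‖Y i k‖ * (‖x i‖ * ‖x k‖) := by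
              rw [Finset.mul_sum]
              refine Finset.sum_congr rfl fun k _ => ?_
              rw [norm_mul]; ring
    _ ≤ ∑ i, ∑ k, ‖Y i k‖ * (star x ⬝ᵥ x).re :=
        Finset.sum_le_sum fun i _ => Finset.sum_le_sum fun k _ =>
          mul_le_mul_of_nonneg_left (hprod i k) (norm_nonneg _)
    _ = (∑ i, ∑ k, ‖Y i k‖) * (star x ⬝ᵥ x).re := by
        rw [Finset.sum_mul]; refine Finset.sum_congr rfl fun i _ => ?_; rw [Finset.sum_mul]

/-- **Weyl along an affine Hermitian pencil**: `|λᵢ(M₀ + uM₁) - λᵢ(M₀ + u₀M₁)| ≤ |u - u₀| Σ|M₁ᵢₖ|`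
(the sorted eigenvalues are Lipschitz in the coupling). [folklore] -/
theorem abs_eigenvalues_pencil_sub_le {M₀ M₁ : Matrix n n ℂ} (h₀ : M₀.IsHermitian)
    (h₁ : M₁.IsHermitian) (u u₀ : ℝ) (i : n) :
    |(isHermitian_add_real_smul h₀ h₁ u).eigenvalues i -
        (isHermitian_add_real_smul h₀ h₁ u₀).eigenvalues i| ≤
      |u - u₀| * ∑ a, ∑ b, ‖M₁ a b‖ := by
  refine abs_eigenvalues_sub_eigenvalues_le _ _ (fun x => ?_) i
  have hsub : M₀ + (u : ℂ) • M₁ - (M₀ + (u₀ : ℂ) • M₁) = ((u - u₀ : ℝ) : ℂ) • M₁ := by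
    rw [Complex.ofReal_sub, sub_smul]; abel
  rw [hsub, smul_mulVec, dotProduct_smul, smul_eq_mul, Complex.re_ofReal_mul, abs_mul,
    mul_assoc]
  exact mul_le_mul_of_nonneg_left (abs_re_rayleigh_le_sum_norm_mul M₁ x) (abs_nonneg _)

/-- **At a coupling of maximal distinct-eigenvalue count the eigenvalue partition and the
order of the distinct eigenvalues are locally constant.** For Hermitian `M₀`, `M₁` and `u₀`
with `#{distinct eigenvalues of M₀ + uM₁} ≤ #{… of M₀ + u₀M₁}` for all `u`: for `u` near `u₀`,
`λᵢ(u) = λⱼ(u) ↔ λᵢ(u₀) = λⱼ(u₀)` and `λᵢ(u₀) < λⱼ(u₀) ⇒ λᵢ(u) < λⱼ(u)` (Weyl + the pattern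
lemma, with `2|u - u₀| Σ|M₁| <` the minimal gap at `u₀`). Kato (1966) II-§1.1, §5.1.
[folklore] -/
theorem eventually_eigenvalues_pattern {M₀ M₁ : Matrix n n ℂ} (h₀ : M₀.IsHermitian)
    (h₁ : M₁.IsHermitian) {u₀ : ℝ}
    (hmax : ∀ u : ℝ, (M₀ + (u : ℂ) • M₁).charpoly.roots.toFinset.card ≤
      (M₀ + (u₀ : ℂ) • M₁).charpoly.roots.toFinset.card) :
    ∀ᶠ u in 𝓝 u₀, (∀ i j,
      (isHermitian_add_real_smul h₀ h₁ u).eigenvalues i =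
          (isHermitian_add_real_smul h₀ h₁ u).eigenvalues j ↔
        (isHermitian_add_real_smul h₀ h₁ u₀).eigenvalues i =
          (isHermitian_add_real_smul h₀ h₁ u₀).eigenvalues j) ∧
      ∀ i j, (isHermitian_add_real_smul h₀ h₁ u₀).eigenvalues i <
          (isHermitian_add_real_smul h₀ h₁ u₀).eigenvalues j →
        (isHermitian_add_real_smul h₀ h₁ u).eigenvalues i <
          (isHermitian_add_real_smul h₀ h₁ u).eigenvalues j := by
  classical
  set g := (isHermitian_add_real_smul h₀ h₁ u₀).eigenvalues with hg
  set R : ℝ := ∑ a, ∑ b, ‖M₁ a b‖ with hR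
  have hR0 : 0 ≤ R := Finset.sum_nonneg fun a _ => Finset.sum_nonneg fun b _ => norm_nonneg _
  -- the gap between distinct eigenvalues at `u₀`
  set Dset : Finset ℝ := ((Finset.univ ×ˢ Finset.univ).filter
    fun p : n × n => g p.1 ≠ g p.2).image fun p => |g p.1 - g p.2| with hDset
  obtain ⟨γ, hγ, hγle⟩ : ∃ γ : ℝ, 0 < γ ∧ ∀ i j, g i ≠ g j → γ ≤ |g i - g j| := by
    by_cases hne : Dset.Nonempty
    · refine ⟨Dset.min' hne, ?_, fun i j hij => Dset.min'_le _ ?_⟩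
      · obtain ⟨p, hp, hpeq⟩ := Finset.mem_image.1 (Dset.min'_mem hne)
        rw [← hpeq]
        exact abs_pos.2 (sub_ne_zero.2 (Finset.mem_filter.1 hp).2)
      · exact Finset.mem_image.2 ⟨(i, j), Finset.mem_filter.2 ⟨Finset.mem_product.2
          ⟨Finset.mem_univ _, Finset.mem_univ _⟩, hij⟩, rfl⟩
    · refine ⟨1, one_pos, fun i j hij => ?_⟩
      exact absurd ⟨_, Finset.mem_image.2 ⟨(i, j), Finset.mem_filter.2 ⟨Finset.mem_product.2
          ⟨Finset.mem_univ _, Finset.mem_univ _⟩, hij⟩, rfl⟩⟩ hne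
  rw [Metric.eventually_nhds_iff]
  refine ⟨γ / (2 * R + 1), by positivity, fun u hu => ?_⟩
  rw [Real.dist_eq] at hu
  set f := (isHermitian_add_real_smul h₀ h₁ u).eigenvalues with hf
  have hc : ∀ i, |f i - g i| ≤ |u - u₀| * R :=
    fun i => abs_eigenvalues_pencil_sub_le h₀ h₁ u u₀ i
  have h2c : 2 * (|u - u₀| * R) < γ := by
    calc 2 * (|u - u₀| * R) ≤ 2 * (γ / (2 * R + 1) * R) := by
          nlinarith [abs_nonneg (u - u₀)]
      _ < γ := by
          rw [div_mul_eq_mul_div, ← mul_div_assoc, div_lt_iff₀ (by positivity)]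
          nlinarith
  refine ⟨fun i j => eq_iff_eq_of_close_of_card_image_le hc
    (fun i j hij => h2c.trans_le (hγle i j hij)) ?_ i j, fun i j hij => ?_⟩
  · rw [← card_toFinset_roots_charpoly,
      ← card_toFinset_roots_charpoly]
    exact hmax u
  · have hgap' : γ ≤ g j - g i := by
      have := hγle i j hij.ne
      rwa [abs_sub_comm, abs_of_pos (sub_pos.2 hij)] at this
    have hi := (abs_le.1 (hc i)).2
    have hj := (abs_le.1 (hc j)).1
    linarith

/-- The lowest multiplicity of a Hermitian matrix as the dimension of its full-space ground
multiplet `⊤ ⊓ ker (M - minEnergyOn M ⊤)` (`Matrix.minEnergyOn_top_holds`,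
`Matrix.groundEnergy_eq_iInf_eigenvalues_holds`, `IsHermitian.card_filter_eigenvalues_eq`).
[folklore] -/
theorem finrank_groundMultiplet_top_eq_card [Nonempty n] {M : Matrix n n ℂ} (hM : M.IsHermitian) :
    Module.finrank ℂ ↥((⊤ : Submodule ℂ (n → ℂ)) ⊓ Module.End.eigenspace (Matrix.toLin' M)
        ((M.minEnergyOn ⊤ : ℝ) : ℂ)) =
      (Finset.univ.filter fun i => hM.eigenvalues i = ⨅ j, hM.eigenvalues j).card := by
  rw [top_inf_eq, Matrix.minEnergyOn_top_holds hM, Matrix.groundEnergy_eq_iInf_eigenvalues_holds hM,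
    hM.card_filter_eigenvalues_eq]

/-- **Local constancy of the lowest multiplicity at a coupling of maximal count**: for Hermitian
`M₀`, `M₁` and a coupling `u₀` of maximal distinct-eigenvalue count, the dimension of the
full-space ground multiplet of `M₀ + uM₁` is constant for `u` near `u₀` (an index attaining the
minimal eigenvalue at `u₀` still attains it at `u`, and the partitions agree).
Kato (1966) II-§5.1. [folklore] -/
theorem eventually_finrank_groundMultiplet_top_eq [Nonempty n] {M₀ M₁ : Matrix n n ℂ}
    (h₀ : M₀.IsHermitian) (h₁ : M₁.IsHermitian) {u₀ : ℝ}
    (hmax : ∀ u : ℝ, (M₀ + (u : ℂ) • M₁).charpoly.roots.toFinset.card ≤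
      (M₀ + (u₀ : ℂ) • M₁).charpoly.roots.toFinset.card) :
    ∀ᶠ u : ℝ in 𝓝 u₀,
      Module.finrank ℂ ↥((⊤ : Submodule ℂ (n → ℂ)) ⊓
          Module.End.eigenspace (Matrix.toLin' (M₀ + (u : ℂ) • M₁))
            (((M₀ + (u : ℂ) • M₁).minEnergyOn ⊤ : ℝ) : ℂ)) =
        Module.finrank ℂ ↥((⊤ : Submodule ℂ (n → ℂ)) ⊓
          Module.End.eigenspace (Matrix.toLin' (M₀ + (u₀ : ℂ) • M₁))
            (((M₀ + (u₀ : ℂ) • M₁).minEnergyOn ⊤ : ℝ) : ℂ)) := by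
  classical
  filter_upwards [eventually_eigenvalues_pattern h₀ h₁ hmax] with u hu
  obtain ⟨hpat, hord⟩ := hu
  set f := (isHermitian_add_real_smul h₀ h₁ u).eigenvalues with hf
  set g := (isHermitian_add_real_smul h₀ h₁ u₀).eigenvalues with hg
  rw [finrank_groundMultiplet_top_eq_card (isHermitian_add_real_smul h₀ h₁ u),
    finrank_groundMultiplet_top_eq_card (isHermitian_add_real_smul h₀ h₁ u₀)]
  -- an index attaining the minimum at `u₀` attains it at `u`
  obtain ⟨i₀, -, hi₀⟩ := Finset.exists_min_image Finset.univ g Finset.univ_nonempty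
  have hgmin : ⨅ j, g j = g i₀ :=
    le_antisymm (ciInf_le (Set.finite_range _).bddBelow i₀) (le_ciInf fun j => hi₀ j (Finset.mem_univ j))
  have hfle : ∀ j, f i₀ ≤ f j := fun j => by
    rcases (hi₀ j (Finset.mem_univ j)).lt_or_eq with hlt | heq
    · exact (hord i₀ j hlt).le
    · exact ((hpat i₀ j).2 heq).le
  have hfmin : ⨅ j, f j = f i₀ :=
    le_antisymm (ciInf_le (Set.finite_range _).bddBelow i₀) (le_ciInf hfle)
  rw [hfmin, hgmin]
  refine Finset.card_bij (fun i _ => i) (fun i hi => ?_) (fun _ _ _ _ h => h) (fun i hi => ⟨i, ?_, rfl⟩)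
  · rw [Finset.mem_filter] at hi ⊢
    exact ⟨hi.1, (hpat i i₀).1 hi.2⟩
  · rw [Finset.mem_filter] at hi ⊢
    exact ⟨hi.1, (hpat i i₀).2 hi.2⟩

end Weyl

end Summit.HubbardSuperconductivity.HubbardSuperconductivity.Theorems
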